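import Literature.AlgebraicGeometry.Motives.MixedHodgeStructureSocle
import Literature.AlgebraicGeometry.Motives.MixedHodgeStructureSplitOverQTensor
import HarnessLib

/-!
# The radical of a mixed Hodge structure: the smallest sub-MHS with semisimple quotient

Dual to the socle (`MixedHodgeStructureSocle`): in the abelian category of mixed Hodge structures
(Cattani–El Zein–Griffiths–Lê, *Hodge Theory*, Thm. 3.2.18; "semisimple := direct sum of simples", p. 270) every
object on a finite-dimensional space has a smallest sub-object with semisimple quotient — its **radical** — and a
largest semisimple quotient `H / rad H`. Fujiki (1.6.2): duality and orthogonal complements of sub-MHS, by which the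
radical of `H` corresponds to the socle of `H^∨`. Namespace `MixedHodgeStructure`; everything proved, no named facts:

* `SubMixedHodgeStructure.isSemisimple_quotient_inf` — `H/(R ∩ R') ↪ H/R ⊕ H/R'`, so sub-MHS with semisimple quotient
  are closed under intersection; `isSemisimple_quotient_of_le` (larger sub-MHS have semisimple quotient too).
* `radical H`, `isSemisimple_quotient_radical`, **`radical_le`** (minimality), `eq_radical`,
  **`radical_eq_bot_iff`** (`H` semisimple iff `rad H = 0`), **`radical_ne_top`** for `V ≠ 0`
  (via the socle of `H^∨`), functoriality **`map_radical_le`**.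

## References

* [CattaniElZeinGriffithsLe2014] E. Cattani et al. (eds.), Hodge Theory (2014), Thm. 3.2.18, Lemma 3.2.20, p. 270.
* [Fujiki1980] A. Fujiki, Duality of mixed Hodge structures of algebraic varieties (1980), (1.6.2).
-/

noncomputable section

open scoped TensorProduct

namespace Literature.AlgebraicGeometry.Motives

namespace MixedHodgeStructure

universe u v

variable {V : Type u} [AddCommGroup V] [Module ℚ V]
variable {V' : Type v} [AddCommGroup V'] [Module ℚ V']
variable {H : MixedHodgeStructure V} {H' : MixedHodgeStructure V'}

/-! ### §1 Sub-MHS with semisimple quotient -/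

/-- The target of a surjective morphism out of a semisimple MHS is semisimple (`H' ≅ H / Ker f`).
[cite: CattaniElZeinGriffithsLe2014, Thm. 3.2.18] -/
theorem IsSemisimple.of_surjective [FiniteDimensional ℚ V] [FiniteDimensional ℚ V'] (h : H.IsSemisimple) (f : Hom H H')
    (hf : Function.Surjective f.toLinearMap) : H'.IsSemisimple :=
  (h.range f).of_bijective f.range.subtype
    ⟨Submodule.injective_subtype _, fun y =>
      ⟨⟨y, by rw [Hom.range_toSubmodule, LinearMap.range_eq_top.2 hf]; trivial⟩, rfl⟩⟩

namespace SubMixedHodgeStructure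

/-- The kernel of `H → H/R ⊕ H/R'` is `R ∩ R'`. [cite: CattaniElZeinGriffithsLe2014, Thm. 3.2.18] -/
theorem ker_prodLift_mkQ (R R' : SubMixedHodgeStructure H) : (Hom.prodLift R.mkQ R'.mkQ).ker = R.inf R' :=
  ext (by
    rw [Hom.ker_toSubmodule, inf_toSubmodule]
    change LinearMap.ker (R.mkQ.toLinearMap.prod R'.mkQ.toLinearMap) = _
    rw [LinearMap.ker_prod]
    change LinearMap.ker R.toSubmodule.mkQ ⊓ LinearMap.ker R'.toSubmodule.mkQ = _
    rw [Submodule.ker_mkQ, Submodule.ker_mkQ])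

/-- **`H/(R ∩ R')` is semisimple when `H/R` and `H/R'` are** (`H/(R ∩ R') ↪ H/R ⊕ H/R'`).
[cite: CattaniElZeinGriffithsLe2014, Thm. 3.2.18 and p. 270] -/
theorem isSemisimple_quotient_inf [FiniteDimensional ℚ V] (R R' : SubMixedHodgeStructure H)
    (hR : R.quotient.IsSemisimple) (hR' : R'.quotient.IsSemisimple) : (R.inf R').quotient.IsSemisimple := by
  let f := Hom.prodLift R.mkQ R'.mkQ
  have hker : f.ker.quotient.IsSemisimple :=
    ((hR.prod hR').range' f).of_bijective' f.coimageToRange f.coimageToRange_bijective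
  rwa [ker_prodLift_mkQ] at hker

/-- If `H/R` is semisimple and `R ⊆ T` then `H/T` (a quotient of `H/R`) is semisimple. [cite: CattaniElZeinGriffithsLe2014, Thm. 3.2.18] -/
theorem isSemisimple_quotient_of_le [FiniteDimensional ℚ V] {R T : SubMixedHodgeStructure H} (h : R.toSubmodule ≤ T.toSubmodule)
    (hR : R.quotient.IsSemisimple) : T.quotient.IsSemisimple :=
  hR.of_surjective (quotientMapLE h) (quotientMapLE_surjective h)

end SubMixedHodgeStructure

/-! ### §2 The radical -/

section Radical

variable (H)

/-- Sub-MHS with semisimple quotient exist in every dimension down to a least one (`H/H = 0` is semisimple).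
[cite: CattaniElZeinGriffithsLe2014, Thm. 3.2.18] -/
private theorem exists_dim [FiniteDimensional ℚ V] : ∃ k : ℕ, ∃ R : SubMixedHodgeStructure H,
    R.quotient.IsSemisimple ∧ Module.finrank ℚ R.toSubmodule = k :=
  ⟨_, SubMixedHodgeStructure.top H, by
    haveI : Subsingleton (V ⧸ (SubMixedHodgeStructure.top H).toSubmodule) := Submodule.Quotient.subsingleton_iff.2 rfl
    exact isSemisimple_of_subsingleton _, rfl⟩

open scoped Classical in
/-- **The radical of `H`**: a sub-MHS with semisimple quotient of minimal dimension (below: the smallest such).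
[cite: CattaniElZeinGriffithsLe2014, Thm. 3.2.18 and p. 270] -/
def radical [FiniteDimensional ℚ V] : SubMixedHodgeStructure H :=
  Classical.choose (Nat.find_spec (exists_dim H))

open scoped Classical in
/-- The defining property of the chosen radical. [cite: CattaniElZeinGriffithsLe2014, Thm. 3.2.18] -/
private theorem radical_spec [FiniteDimensional ℚ V] :
    (radical H).quotient.IsSemisimple ∧ Module.finrank ℚ (radical H).toSubmodule = Nat.find (exists_dim H) :=
  Classical.choose_spec (Nat.find_spec (exists_dim H))

/-- **`H / rad H` is semisimple.** [cite: CattaniElZeinGriffithsLe2014, Thm. 3.2.18 and p. 270] -/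
theorem isSemisimple_quotient_radical [FiniteDimensional ℚ V] : (radical H).quotient.IsSemisimple :=
  (radical_spec H).1

open scoped Classical in
/-- Minimality of the dimension of the radical. [cite: CattaniElZeinGriffithsLe2014, Thm. 3.2.18] -/
theorem finrank_radical_le [FiniteDimensional ℚ V] (R : SubMixedHodgeStructure H) (hR : R.quotient.IsSemisimple) :
    Module.finrank ℚ (radical H).toSubmodule ≤ Module.finrank ℚ R.toSubmodule := by
  rw [(radical_spec H).2]
  exact Nat.find_min' (exists_dim H) ⟨R, hR, rfl⟩

variable {H}

/-- **The radical is contained in every sub-MHS with semisimple quotient** (`rad ∩ R` has semisimple quotient and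
dimension `≥ dim rad`). [cite: CattaniElZeinGriffithsLe2014, Thm. 3.2.18 and p. 270] -/
theorem radical_le [FiniteDimensional ℚ V] (R : SubMixedHodgeStructure H) (hR : R.quotient.IsSemisimple) :
    (radical H).toSubmodule ≤ R.toSubmodule := by
  have hinf : ((radical H).inf R).quotient.IsSemisimple :=
    SubMixedHodgeStructure.isSemisimple_quotient_inf _ _ (isSemisimple_quotient_radical H) hR
  have hle : ((radical H).inf R).toSubmodule ≤ (radical H).toSubmodule := by
    rw [SubMixedHodgeStructure.inf_toSubmodule]; exact inf_le_left
  have heq : ((radical H).inf R).toSubmodule = (radical H).toSubmodule :=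
    Submodule.eq_of_le_of_finrank_le hle (finrank_radical_le H _ hinf)
  rw [← heq, SubMixedHodgeStructure.inf_toSubmodule]
  exact inf_le_right

/-- **Characterisation**: the radical is the unique sub-MHS with semisimple quotient contained in all such.
[cite: CattaniElZeinGriffithsLe2014, Thm. 3.2.18 and p. 270] -/
theorem eq_radical [FiniteDimensional ℚ V] (M : SubMixedHodgeStructure H) (hM : M.quotient.IsSemisimple)
    (hmin : ∀ R : SubMixedHodgeStructure H, R.quotient.IsSemisimple → M.toSubmodule ≤ R.toSubmodule) : M = radical H :=
  SubMixedHodgeStructure.ext (le_antisymm (hmin _ (isSemisimple_quotient_radical H)) (radical_le M hM))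

/-- **The sub-MHS with semisimple quotient are exactly those containing the radical.**
[cite: CattaniElZeinGriffithsLe2014, Thm. 3.2.18 and p. 270] -/
theorem isSemisimple_quotient_iff_radical_le [FiniteDimensional ℚ V] (R : SubMixedHodgeStructure H) :
    R.quotient.IsSemisimple ↔ (radical H).toSubmodule ≤ R.toSubmodule :=
  ⟨radical_le R, fun h => SubMixedHodgeStructure.isSemisimple_quotient_of_le h (isSemisimple_quotient_radical H)⟩

/-- **`H` is semisimple iff its radical vanishes.** [cite: CattaniElZeinGriffithsLe2014, Thm. 3.2.18 and p. 270] -/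
theorem radical_eq_bot_iff [FiniteDimensional ℚ V] : (radical H).toSubmodule = ⊥ ↔ H.IsSemisimple := by
  have hb : Function.Bijective (SubMixedHodgeStructure.bot H).mkQ.toLinearMap := by
    refine ⟨?_, Submodule.mkQ_surjective _⟩
    rw [← LinearMap.ker_eq_bot]
    exact Submodule.ker_mkQ _
  constructor
  · intro h
    have hbot : (SubMixedHodgeStructure.bot H).quotient.IsSemisimple :=
      (isSemisimple_quotient_iff_radical_le _).2 (by rw [h]; exact bot_le)
    exact hbot.of_bijective' _ hb
  · intro h
    exact le_bot_iff.1 (radical_le (SubMixedHodgeStructure.bot H) (h.quotient _))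

/-- The radical of a semisimple MHS vanishes. [cite: CattaniElZeinGriffithsLe2014, p. 270] -/
theorem IsSemisimple.radical_eq_bot [FiniteDimensional ℚ V] (h : H.IsSemisimple) : radical H = SubMixedHodgeStructure.bot H :=
  SubMixedHodgeStructure.ext ((radical_eq_bot_iff.2 h).trans (SubMixedHodgeStructure.bot_toSubmodule H).symm)

/-- **A non-zero MHS has a proper radical** — `H` has a non-zero semisimple quotient: for the socle `S'` of `H^∨`
(non-zero), the sub-MHS `K = S'_⊥ ⊆ H` has `(H/K)^∨ ≅ K^⊥ = S'` semisimple. [cite: Fujiki1980, (1.6.2)]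
[cite: CattaniElZeinGriffithsLe2014, Thm. 3.2.18 and p. 270] -/
theorem radical_ne_top [FiniteDimensional ℚ V] [Nontrivial V] : (radical H).toSubmodule ≠ ⊤ := by
  let S' := socle H.dual
  let K : SubMixedHodgeStructure H := S'.annihilator.comap (Hom.bidual H)
  have hK : K.toSubmodule = S'.toSubmodule.dualCoannihilator := by
    change (S'.annihilator.comap (Hom.bidual H)).toSubmodule = _
    rw [SubMixedHodgeStructure.comap_toSubmodule, SubMixedHodgeStructure.annihilator_toSubmodule, Hom.bidual_toLinearMap]
    rfl
  have hKann : K.annihilator = S' :=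
    SubMixedHodgeStructure.ext (by rw [SubMixedHodgeStructure.annihilator_toSubmodule, hK, Subspace.dualCoannihilator_dualAnnihilator_eq])
  -- `H/K` is semisimple: its dual is `K^⊥ = S'`, the (semisimple) socle of `H^∨`
  have hq : K.quotient.IsSemisimple := by
    have hd : K.quotient.dual.IsSemisimple :=
      (hKann ▸ isSemisimple_socle H.dual : K.annihilator.toMixedHodgeStructure.IsSemisimple).of_bijective'
        K.quotientDualHom K.quotientDualHom_bijective
    exact isSemisimple_dual_iff.1 hd
  -- `K ≠ ⊤` because `S' ≠ 0`
  intro htop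
  have hKtop : K.toSubmodule = ⊤ := eq_top_iff.2 (htop ▸ radical_le K hq)
  have hS' : S'.toSubmodule = ⊥ := by
    rw [← hKann, SubMixedHodgeStructure.annihilator_toSubmodule, hKtop, Submodule.dualAnnihilator_top]
  exact socle_ne_bot hS'

/-- **Morphisms map radicals into radicals**: `H / f⁻¹(rad H')` embeds in the semisimple `H' / rad H'`.
[cite: CattaniElZeinGriffithsLe2014, Thm. 3.2.18] -/
theorem map_radical_le [FiniteDimensional ℚ V] [FiniteDimensional ℚ V'] (f : Hom H H') :
    (radical H).toSubmodule.map f.toLinearMap ≤ (radical H').toSubmodule := by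
  let K : SubMixedHodgeStructure H := (radical H').comap f
  have hf : ∀ x ∈ K.toSubmodule, f.toLinearMap x ∈ (radical H').toSubmodule := fun x hx => by
    rw [SubMixedHodgeStructure.comap_toSubmodule] at hx; exact hx
  let g := K.quotientMap (radical H') f hf
  have hg : Function.Injective g.toLinearMap := by
    refine (injective_iff_map_eq_zero _).2 fun z hz => ?_
    obtain ⟨x, rfl⟩ := Submodule.mkQ_surjective _ z
    rw [Submodule.mkQ_apply, SubMixedHodgeStructure.quotientMap_mk, Submodule.Quotient.mk_eq_zero] at hz
    exact (Submodule.Quotient.mk_eq_zero _).2 (by rw [SubMixedHodgeStructure.comap_toSubmodule]; exact hz)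
  have hK : K.quotient.IsSemisimple :=
    ((isSemisimple_quotient_radical H').range' g).of_bijective' g.rangeRestrict (g.rangeRestrict_bijective_of_injective hg)
  have hle := radical_le K hK
  rw [SubMixedHodgeStructure.comap_toSubmodule] at hle
  exact Submodule.map_le_iff_le_comap.2 hle

/-- Elementwise form. [cite: CattaniElZeinGriffithsLe2014, Thm. 3.2.18] -/
theorem Hom.apply_mem_radical [FiniteDimensional ℚ V] [FiniteDimensional ℚ V'] (f : Hom H H') {x : V}
    (hx : x ∈ (radical H).toSubmodule) : f.toLinearMap x ∈ (radical H').toSubmodule :=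
  map_radical_le f ⟨x, hx, rfl⟩

end Radical

end MixedHodgeStructure

end Literature.AlgebraicGeometry.Motives
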